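import Mathlib.GroupTheory.OrderOfElement
import Mathlib.Algebra.Group.Action.Defs
import Mathlib.Data.ZMod.Basic
import Mathlib.Tactic.Ring
import Mathlib.Tactic.Abel
import Mathlib.Algebra.BigOperators.Group.Finset.Basic
import HarnessLib

/-!
# The Kummer-point model behind I1 (`Kum4FixedFourfoldMeetsTranslates`): four elementary lemmas
(cell `hodge-kum4`, seat p2; kernel companions of the cell's paper proof HOME/p2/I1-PROOF.md,
HOME/p2/I1GEO-TRANSPORT.md of route `KummerFixedLocus`'s residual I1R / I1geo)

HONEST FRAMING.  These are ABSTRACT algebraic lemmas — group theory and linear algebra over an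
arbitrary additive group — not statements about `K⁴(A)`: they are the machine-checked core of the
cell's paper proof that the fixed fourfold `W` of the Kummer involution meets each `Γ`-translate `gW`
(`g ≠ 1`) in ONE REDUCED POINT.  The geometric identifications (points of `K⁴(A)` as length-`5`
subschemes of `A`, `T_ξ A^[5] = ⊕ᵢ T_{xᵢ} A` at a reduced `ξ`, Cartan linearisation, equivariant
deformation to an arbitrary `X` of `Kum⁴`-type) are NOT in the tree and are not claimed here; the
residual stays `@[conjecture]`-tagged in `KummerFixedLocusDefs`.

1. `exists_conj_eq_involution_mul` — an involution `ι` inverting elementwise a subgroup `Γ` of odd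
   order is `Γ`-conjugate to every `ι g`, `g ∈ Γ` (`h ι h⁻¹ = ι h⁻²`, and squaring is onto in odd
   order).  For `Aut₀(X) = Γ ⋊ ⟨ι⟩`, `|Γ| = 625`: all `625` involutions are conjugate, so every Kummer
   fixed datum is a `Γ`-translate of any other (literature seat flag F6).
2. `neg_coset_subset_iff` — in an additive group of odd order the coset `a + ⟨u⟩` is stable under
   `x ↦ −x` iff `a ∈ ⟨u⟩`: among the `t_u`-fixed points `a + ⟨u⟩` (`a ∈ A[5]`) of `K⁴(A)` exactly
   the one through `0` is fixed by `−1`, i.e. `Fix⟨−1, t_u⟩ = {⟨u⟩}` set-theoretically.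
3. `eq_zero_of_neg_fixed_of_reflect_fixed` (and `_shift_fixed`, `_odd`), `neg_fixed_iff` — on
   vectors `v : ℤ/5 → M` with `Σ vₖ = 0` (the model of `T_{⟨u⟩} K⁴(A)`, `vₖ ∈ M = T₀A` the component
   at the point `k u`), the involutions `ι : vₖ ↦ −v₋ₖ` (tangent action of `−1`) and
   `ι′ : vₖ ↦ −v₂₋ₖ` (tangent action of `x ↦ 2u − x = t_u ∘ (−1) ∘ t_u⁻¹`) have no common fixed
   vector but `0`, for ANY additive group `M` (`v` is `2`-periodic on `ℤ/5`, hence constant, and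
   `5v₀ = 0 = 2v₀`; stated for every odd `p` as well); and the `ι`-fixed sum-zero vectors are
   exactly `(0, a, b, −b, −a)`.  With `M = T₀A ≅ ℂ²`: `T W₀ ∩ T (t_u W₀) = 0` at `⟨u⟩`
   (transversality) and `dim T_{⟨u⟩} W₀ = 4` (`⟨u⟩` lies on the fourfold component).  All maps are
   given by their defining identities as hypotheses (no definitions are introduced).
4. `smul_eq_self_of_fixed_of_mem_translate` — Step 1 of the transport argument
   (HOME/p2/I1GEO-TRANSPORT.md) as an abstract lemma on a group action: for an involution `ι` inverting
   `g` of odd order, `Fix(ι) ∩ g·Fix(ι) ⊆ Fix(g)`; so `W ∩ gW ⊆ Fix⟨ι, g⟩` (a dihedral group `D_{ord g}`).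
-/

namespace Summit.Ventures.HodgeKum4.KummerPointModel

/-! ### 1. Involutions inverting an odd-order subgroup are all conjugate -/

section Group

variable {G : Type*} [Group G]

/-- `h ι h⁻¹ = ι h⁻²` when `ι² = 1` and `ι h ι = h⁻¹`. -/
theorem conj_involution_eq (ι h : G) (hι : ι * ι = 1) (hinv : ι * h * ι = h⁻¹) :
    h * ι * h⁻¹ = ι * (h⁻¹ * h⁻¹) := by
  have key : h * ι = ι * h⁻¹ := by
    have := congrArg (fun x => ι * x) hinv
    simp only [← mul_assoc, hι, one_mul] at this
    exact this
  rw [key, mul_assoc]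

/-- In a subgroup of odd order every element is a square. -/
theorem exists_mul_self_eq_of_odd_card (Γ : Subgroup G) (hodd : Odd (Nat.card Γ)) (g : G)
    (hg : g ∈ Γ) : ∃ k ∈ Γ, k * k = g := by
  obtain ⟨m, hm⟩ := hodd
  refine ⟨g ^ (m + 1), Γ.pow_mem hg _, ?_⟩
  have hcard : g ^ Nat.card Γ = 1 :=
    orderOf_dvd_iff_pow_eq_one.mp (Γ.orderOf_dvd_natCard hg)
  rw [← pow_add, show m + 1 + (m + 1) = Nat.card Γ + 1 by omega, pow_succ, hcard, one_mul]

/-- **All the involutions `ι g`, `g ∈ Γ`, are `Γ`-conjugate to `ι`** when `ι` is an involution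
inverting the odd-order subgroup `Γ` elementwise. -/
theorem exists_conj_eq_involution_mul (Γ : Subgroup G) (hodd : Odd (Nat.card Γ)) (ι : G)
    (hι : ι * ι = 1) (hinv : ∀ g ∈ Γ, ι * g * ι = g⁻¹) (g : G) (hg : g ∈ Γ) :
    ∃ h ∈ Γ, h * ι * h⁻¹ = ι * g := by
  obtain ⟨k, hk, hkk⟩ := exists_mul_self_eq_of_odd_card Γ hodd g hg
  refine ⟨k⁻¹, Γ.inv_mem hk, ?_⟩
  rw [conj_involution_eq ι k⁻¹ hι (hinv _ (Γ.inv_mem hk)), inv_inv, hkk]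

/-- The product of two distinct such involutions lies in `Γ ∖ 1`: `(ι g)·(ι g') ∈ Γ` — concretely
`ι g ι g' = g⁻¹ g'`, so two Kummer involutions never commute unless equal (`|Γ|` odd, no element of
order `2`): the group they generate is dihedral of odd order `2·ord(g⁻¹g')`. -/
theorem involution_mul_involution_mul (ι g g' : G) (hinv : ι * g * ι = g⁻¹) :
    ι * g * (ι * g') = g⁻¹ * g' := by
  rw [← mul_assoc, hinv]

end Group

/-! ### 2. Symmetric cosets of a cyclic subgroup in odd order -/

section Coset

variable {A : Type*} [AddCommGroup A]

/-- In an additive group of odd order, `2 • a ∈ H` implies `a ∈ H`. -/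
theorem mem_of_two_nsmul_mem (hodd : Odd (Nat.card A)) (H : AddSubgroup A) (a : A)
    (h2 : (2 : ℕ) • a ∈ H) : a ∈ H := by
  obtain ⟨m, hm⟩ := hodd
  have ha : a = (m + 1) • ((2 : ℕ) • a) - Nat.card A • a := by
    rw [smul_smul, hm, show (m + 1) * 2 = 2 * m + 1 + 1 by ring, succ_nsmul, add_sub_cancel_left]
  rw [ha, card_nsmul_eq_zero', sub_zero]
  exact H.nsmul_mem h2 _

/-- **The coset `a + ⟨u⟩` is stable under `x ↦ −x` iff `a ∈ ⟨u⟩`** (additive group of odd order). -/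
theorem neg_coset_subset_iff (hodd : Odd (Nat.card A)) (u a : A) :
    (∀ x, x - a ∈ AddSubgroup.zmultiples u → -x - a ∈ AddSubgroup.zmultiples u) ↔
      a ∈ AddSubgroup.zmultiples u := by
  constructor
  · intro h
    have h0 : -a - a ∈ AddSubgroup.zmultiples u := h a (by simp)
    have h2 : (2 : ℕ) • a ∈ AddSubgroup.zmultiples u := by
      have := (AddSubgroup.zmultiples u).neg_mem h0
      rwa [neg_sub, sub_neg_eq_add, ← two_nsmul] at this
    exact mem_of_two_nsmul_mem hodd _ a h2
  · intro ha x hx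
    have : -x - a = -(x - a) - (2 : ℕ) • a := by rw [two_nsmul]; abel
    rw [this]
    exact (AddSubgroup.zmultiples u).sub_mem ((AddSubgroup.zmultiples u).neg_mem hx)
      ((AddSubgroup.zmultiples u).nsmul_mem ha _)

end Coset

/-! ### 3. The tangent model at `⟨u⟩` -/

section Tangent

variable {M : Type*} [AddCommGroup M]

/-- The five residues mod `5`. -/
private theorem zmod5_cases (k : ZMod 5) : k = 0 ∨ k = 1 ∨ k = 2 ∨ k = 3 ∨ k = 4 := by
  revert k; decide

/-- **No common fixed vector of `ι : vₖ ↦ −v₋ₖ` and `ι′ : vₖ ↦ −v₂₋ₖ` among the sum-zero vectors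
`v : ℤ/5 → M`**, for ANY additive group `M` (`v` is `2`-periodic on `ℤ/5`, hence constant, and
`5v₀ = 0 = 2v₀`).  Model of `T_{⟨u⟩} W₀ ∩ T_{⟨u⟩}(t_u W₀) = 0`: the fixed fourfold and its translate
meet transversally at `⟨u⟩` (`ι` = tangent action of `−1`, `ι′` = tangent action of
`t_u ∘ (−1) ∘ t_u⁻¹ : x ↦ 2u − x`, `vₖ ∈ T₀A` the component at the point `k u`). -/
theorem eq_zero_of_neg_fixed_of_reflect_fixed (v : ZMod 5 → M) (e₁ : ∀ k, v (-k) = -v k)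
    (e₂ : ∀ k, v (2 - k) = -v k) (hs : v 0 + v 1 + v 2 + v 3 + v 4 = 0) : v = 0 := by
  -- `2`-periodicity
  have per : ∀ k, v (k + 2) = v k := fun k => by
    have := e₂ (-k)
    rw [e₁, neg_neg, show (2 : ZMod 5) - -k = k + 2 by ring] at this
    exact this
  have h02 : v 2 = v 0 := by simpa using per 0
  have h24 : v 4 = v 2 := by have := per 2; rwa [show (2 : ZMod 5) + 2 = 4 by decide] at this
  have h41 : v 1 = v 4 := by have := per 4; rwa [show (4 : ZMod 5) + 2 = 1 by decide] at this
  have h13 : v 3 = v 1 := by have := per 1; rwa [show (1 : ZMod 5) + 2 = 3 by decide] at this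
  have c1 : v 1 = v 0 := by rw [h41, h24, h02]
  have c2 : v 2 = v 0 := h02
  have c3 : v 3 = v 0 := by rw [h13, c1]
  have c4 : v 4 = v 0 := by rw [h24, h02]
  -- `5 v₀ = 0` and `2 v₀ = 0`
  have h5 : v 0 + v 0 + v 0 + v 0 + v 0 = 0 := by rw [c1, c2, c3, c4] at hs; exact hs
  have h2 : v 0 + v 0 = 0 := by
    have := e₁ 0; rw [neg_zero] at this
    nth_rewrite 1 [this]; exact neg_add_cancel (v 0)
  have h0 : v 0 = 0 := by
    have : v 0 = (v 0 + v 0 + v 0 + v 0 + v 0) - (v 0 + v 0) - (v 0 + v 0) := by abel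
    rw [this, h5, h2, sub_zero, sub_zero]
  funext k
  rcases zmod5_cases k with rfl | rfl | rfl | rfl | rfl
  · exact h0
  · rw [c1, h0]; rfl
  · rw [c2, h0]; rfl
  · rw [c3, h0]; rfl
  · rw [c4, h0]; rfl

/-- The `D₅`-form: a sum-zero vector fixed by `ι` and by the cyclic shift `τ : vₖ ↦ vₖ₋₁` (tangent
action of `t_u`, which permutes the five points of `⟨u⟩`) is `0`; equivalent to the previous lemma
since `ι′ = τ ι τ⁻¹` (`(τ ι τ⁻¹ v)ₖ = −v₋₍ₖ₋₁₎₊₁ = −v₂₋ₖ`). -/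
theorem eq_zero_of_neg_fixed_of_shift_fixed (v : ZMod 5 → M) (e₁ : ∀ k, v (-k) = -v k)
    (eτ : ∀ k, v (k - 1) = v k) (hs : v 0 + v 1 + v 2 + v 3 + v 4 = 0) : v = 0 := by
  refine eq_zero_of_neg_fixed_of_reflect_fixed v e₁ (fun k => ?_) hs
  -- `v (2 - k) = v (-(k - 1) + 1) = v (-(k - 1)) = - v (k - 1) = - v k`
  have h1 : v (2 - k) = v (-(k - 1)) := by
    have := eτ (2 - k); rw [show (2 : ZMod 5) - k - 1 = -(k - 1) by ring] at this; exact this.symm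
  rw [h1, e₁, eτ]

/-- **The `ι`-fixed sum-zero vectors are exactly `(0, a, b, −b, −a)`** (`a, b ∈ M` free): with
`M = T₀A ≅ ℂ²` the tangent space of `Fix(−1)` at `⟨u⟩` is `≅ M × M`, of dimension `4` — so `⟨u⟩`
lies on the FOURFOLD component `W₀` of `Fix(−1)`. -/
theorem neg_fixed_iff (v : ZMod 5 → M) :
    ((∀ k, v (-k) = -v k) ∧ v 0 + v 1 + v 2 + v 3 + v 4 = 0) ↔
      (v 0 = 0 ∧ v 4 = -v 1 ∧ v 3 = -v 2) := by
  constructor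
  · rintro ⟨e₁, hs⟩
    have h4 : v 4 = -v 1 := by have := e₁ 1; rwa [show (-1 : ZMod 5) = 4 by decide] at this
    have h3 : v 3 = -v 2 := by have := e₁ 2; rwa [show (-2 : ZMod 5) = 3 by decide] at this
    refine ⟨?_, h4, h3⟩
    rw [h3, h4] at hs
    have : v 0 + v 1 + v 2 + -v 2 + -v 1 = v 0 := by abel
    rwa [this] at hs
  · rintro ⟨h0, h4, h3⟩
    refine ⟨fun k => ?_, ?_⟩
    · rcases zmod5_cases k with rfl | rfl | rfl | rfl | rfl
      · rw [neg_zero, h0, neg_zero]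
      · rw [show (-1 : ZMod 5) = 4 by decide, h4]
      · rw [show (-2 : ZMod 5) = 3 by decide, h3]
      · rw [show (-3 : ZMod 5) = 2 by decide, h3, neg_neg]
      · rw [show (-4 : ZMod 5) = 1 by decide, h4, neg_neg]
    · rw [h0, h4, h3]; abel

end Tangent

/-! ### 3′. The same vanishing for every odd `p` (outlook `Kum^{p−1}`; not used for H3) -/

section Odd

variable {p : ℕ} [NeZero p] {M : Type*} [AddCommGroup M]

/-- **For odd `p`, `ι : vₖ ↦ −v₋ₖ` and `ι′ : vₖ ↦ −v₂₋ₖ` have no common fixed sum-zero vector on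
`ℤ/p → M`** (any additive group `M`): `v` is `2`-periodic and `2` generates `ℤ/p`, so `v` is constant
with `p v₀ = 0 = 2 v₀`.  (Kummer point of `K^{p−1}(A)`: `Fix⟨−1, t_u⟩ = {⟨u⟩}` is a reduced point and
the two fixed loci through it are transversal, for every odd `p`.) -/
theorem eq_zero_of_neg_fixed_of_reflect_fixed_odd (hp : Odd p) (v : ZMod p → M)
    (e₁ : ∀ k, v (-k) = -v k) (e₂ : ∀ k, v (2 - k) = -v k) (hs : ∑ k, v k = 0) : v = 0 := by
  have per : ∀ k, v (k + 2) = v k := fun k => by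
    have := e₂ (-k)
    rw [e₁, neg_neg, show (2 : ZMod p) - -k = k + 2 by ring] at this
    exact this
  -- constancy along even naturals, then everywhere since `2 (m + 1) = p + 1 ≡ 1`
  have even : ∀ n : ℕ, v ((2 * n : ℕ) : ZMod p) = v 0 := by
    intro n
    induction n with
    | zero => simp
    | succ n ih =>
      rw [show ((2 * (n + 1) : ℕ) : ZMod p) = ((2 * n : ℕ) : ZMod p) + 2 by push_cast; ring, per, ih]
  obtain ⟨m, hm⟩ := hp
  have const : ∀ k, v k = v 0 := by
    intro k
    have hk : k = ((2 * ((m + 1) * k.val) : ℕ) : ZMod p) := by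
      push_cast
      rw [ZMod.natCast_zmod_val, ← mul_assoc, show (2 : ZMod p) * (m + 1 : ZMod p) =
        ((2 * m + 1 + 1 : ℕ) : ZMod p) by push_cast; ring, ← hm]
      simp
    rw [hk, even]
  have hp0 : p • v 0 = 0 := by
    have : ∑ k, v k = ∑ _k : ZMod p, v 0 := Finset.sum_congr rfl fun k _ => const k
    rw [this, Finset.sum_const, Finset.card_univ, ZMod.card] at hs
    exact hs
  have h2 : 2 • v 0 = 0 := by
    have := e₁ 0; rw [neg_zero] at this
    rw [two_nsmul]; nth_rewrite 1 [this]; exact neg_add_cancel (v 0)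
  have h0 : v 0 = 0 := by
    have key : (2 * m + 1) • v 0 = m • (2 • v 0) + v 0 := by
      rw [smul_smul, succ_nsmul, mul_comm]
    rw [← hm, hp0, h2, smul_zero, zero_add] at key
    exact key.symm
  funext k
  rw [const, h0]; rfl

end Odd

/-! ### 4. Step 1 of the transport argument: `W ∩ gW ⊆ Fix⟨ι, g⟩` (abstract group action) -/

section Transport

variable {G : Type*} [Group G] {S : Type*} [MulAction G S]

/-- If `a • x = x` then `a ^ n • x = x` (local copy of a standard one-liner, cf.
`Literature.GroupTheory.SpecificGroups` `pow_smul_eq_self`). -/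
private theorem pow_smul_eq_self_of_smul_eq_self (a : G) {x : S} (h : a • x = x) : ∀ n : ℕ, a ^ n • x = x
  | 0 => by rw [pow_zero, one_smul]
  | n + 1 => by rw [pow_succ, mul_smul, h, pow_smul_eq_self_of_smul_eq_self a h n]

/-- **`Fix(ι) ∩ g·Fix(ι) ⊆ Fix(g)`** for an involution `ι` inverting an element `g` of odd order (Step 1
of HOME/p2/I1GEO-TRANSPORT.md: a point of the fixed fourfold `W = Fix(ι)` lying on the translate `gW` is
fixed by `g`, because `g ι g⁻¹ = ι g⁻²` fixes it, whence `g² x = x`, whence `g x = x` as `g` has odd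
order).  Hence `W ∩ gW ⊆ Fix⟨ι, g⟩`, a dihedral group of order `2·ord(g)`. -/
theorem smul_eq_self_of_fixed_of_mem_translate (ι g : G) (hι : ι * ι = 1) (hinv : ι * g * ι = g⁻¹)
    (hodd : Odd (orderOf g)) {x y : S} (hx : ι • x = x) (hy : ι • y = y) (hxy : x = g • y) :
    g • x = x := by
  -- `g ι = ι g⁻¹`, so `(ι g⁻¹ g⁻¹) • x = (g ι g⁻¹) • x = g • ι • y = x`
  have key : g * ι = ι * g⁻¹ := by
    have := congrArg (fun z => ι * z) hinv
    simp only [← mul_assoc, hι, one_mul] at this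
    exact this
  have h2 : (g⁻¹ * g⁻¹) • x = x := by
    have h1 : (g * ι * g⁻¹) • x = x := by
      rw [mul_smul, mul_smul, hxy, inv_smul_smul, hy]
    rw [key, mul_assoc, mul_smul, ← hx] at h1
    -- h1 : ι • (g⁻¹ * g⁻¹) • ι • x = ι • x  ⇒ cancel `ι`
    have := congrArg (fun z => ι • z) h1
    simp only [smul_smul, hι, one_smul, ← mul_assoc] at this
    simpa [mul_smul, hx] using this
  -- `g⁻¹ ^ 2` fixes `x`, hence so does `g⁻¹ ^ (2(m+1)) = g⁻¹ ^ ord · g⁻¹ = g⁻¹`, hence `g`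
  obtain ⟨m, hm⟩ := hodd
  have hsq : (g⁻¹ ^ 2) • x = x := by rw [pow_two]; exact h2
  have hpow := pow_smul_eq_self_of_smul_eq_self (g⁻¹ ^ 2) hsq (m + 1)
  rw [← pow_mul, show 2 * (m + 1) = orderOf g + 1 by omega, pow_succ, ← orderOf_inv, pow_orderOf_eq_one,
    one_mul] at hpow
  -- `g⁻¹ • x = x` ⇒ `g • x = x`
  have := congrArg (fun z => g • z) hpow
  simpa using this.symm

end Transport

end Summit.Ventures.HodgeKum4.KummerPointModel
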